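import Summits.QuantumFields.BalabanUV.Beta.EriceRemainderEnclosureHistoryAutonomyComparisonAgeCompositionDecayReduction

/-!
# EriceRemainderEnclosureHistoryAutonomyComparisonAgeCompositionThreeAgesDefectReduction — (E87i) route (N), first order, THREE loaded ages `{1,k₂,k₃}`:
# the chain letters at the MIDDLE level made explicit (the top ratio is the old row mass, the carried ratio crosses the silent levels unchanged, the middle
# ratio `ρ_{k₂} = x̃₂·(1 + θ₃(·;k₂)·x̃₃∕(1−x̃₃))∕(1 − Ω₃)`), its FLOW MAJORANT `ρ_{k₂} ≤ ρUp` (loads undamped, the `k₂`-lag defect of the old age with its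
# dampings at the floor), and the REDUCTION of the static family (S-h♯) ((E87e); the per-pair entering-lag family with NO growth factor) at a pin to a
# DAMPING-FREE, CHAIN-FREE PRODUCT INEQUALITY (★h♯) between the levels and the loads — every damping at its own worst end

Cell `pub-balaban`, β-function sub-cell, BINDER row D4 «RemainderConst leaves for Bałaban's split» (`HOME/BINDER-OWNERS.md`; owner lineage `b2b-balaban-beta-an4`;
this file by co-owner #2 lineage `b2b-balaban-beta-d4-p2`, generation 78), β-FLOW TEAM duty (1), FREEZE (0) honoured (def-free; imports (E84a); uses (E82c)
`kernel_zero` ∕ `rho_zero` ∕ `beta_zero`, (E82b) `kernel_entry_le` ∕ `row_mass_le` ∕ `load_le_of_window`, (E75a) `defect_nonneg`, (E84a)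
`inv_prod_le_prod_damping` BY NAME; nothing restated).

HONEST FRAMING (page 1, verbatim and binding).  *"Discharging BetaPertH makes Bałaban's UV stability UNCONDITIONAL — a real constructive-QFT result; it is
NOT the continuum limit and NOT the Clay problem."*  THIS FILE DISCHARGES NOTHING OF THE KIND.  Elementary real analysis about ABSTRACT functionals on a box
]0,γ]^ℕ with displayed floors, profiles and signs, and the FIRST-ORDER renewal objects of route (N) built from them — hypotheses of a census, not facts; the
form, signs, ages and moments of Bałaban's (1.22) limit functional are NOT PRINTED ([I] p. 298; GAPS G-t4-U2-1∕-2) and NOT asserted.  Row D4 class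
UNCHANGED (critical-path width 0; instance 0∕1; D4 DISCHARGE NO DATE).  HONEST DEPENDENCY: continuum YM on T⁴ ⇐ BetaPertH ∧ nine spine estimates (0/9
proved); BetaPertH ⇐ (D1) ∧ (D4) ∧ CAP+tail; G-an2-4 gates asym, D1 and NE2/3/4.

THE POINT (census sense (α); route (N); README `HOME/b2b-balaban-beta-d4-p2/g78/e87/README.md` §3).  The (E84a) pattern («every damping at its own worst
end») FAILS for (S-h)∕(S-h♭) (generation-78 census: their decoupled forms read `+0.18∕+0.32∕+0.44` at `k₃ = 16∕32∕64` on benign benchmark flows) but becomes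
affordable once the growth chain is replaced by the sup bound ((E87e), (S-h♯)): the decoupled damping-free form of (S-h♯), (★h♯) below, reads
`−0.43∕−0.39∕−0.29∕−0.22∕−0.18∕−0.16∕−0.13∕−0.12` at `k₃ = 8∕16∕32∕64∕96∕128∕192∕256` on every benchmark three-age flow (8 regimes, pins `≤ 2`, every
`k₂`; class-independent by construction; kit j335233) — decrements halving, never violated.  §1 the chain letters of the three-age profile at the middle
level: **`rho_top_three`** (`ρ k₃ n = x̃₃(n)`), **`beta_mid_three`** (`β i n k₃ = x̃₃∕(1−x̃₃)` for `k₂ < i ≤ k₃`), **`rho_mid_three`**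
(`ρ k₂ n = x̃₂(n)·(1 + θ k₃ n k₂·x̃₃(n)∕(1−x̃₃(n)))∕(1 − Σ_{l<k₂} KL k₃ n l)`).  §2 **`rho_mid_three_le`**: at every pin `p ≥ 1`, `ρ k₂ p ≤ ρUp_p :=
(k₂q_p)·(1 + ϑ₂(p)·(k₃c_p∕(1 − k₃c_p)))∕(1 − k₂c_p)` with `q_p = L_{k₂}h_{p+k₂}³∕2`, `c_p = L_{k₃}h_{p+k₃}³∕2`,
`ϑ₂(p) = 1 − (h_{p+k₃+k₂}∕h_{p+k₃})³·(Π_{t∈[p+k₃+1,p+k₃+k₂]}(1+F_t))⁻¹`, `F_t = Σ_j L_jh_{t+j}³∕2`.  §3 **`static_defect_sup_of_product`**: (S-h♯) at the pin `m`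
(for every truncation `j ≥ m+1+k₃`) from **(★h♯)**: with `r_m = (h_{m+k₃+1}∕h_{m+k₃})³`, `Pf(a,b) = (Π_{t∈[a,b]}(1+F_t))⁻¹`,
`ALo_j(p) = q_p·Σ_{l<k₂} [p+1+l ≤ j]·Pf(p+1+l, p+k₂)·max(1 − ρUp_{p+1+l}, 0)`:
`r_m·q_{m+1+k₃}·#{l<k₂ : m+2+k₃+l ≤ j} ≤ (1 − k₃c_{m+2})·((1−r_m)·Σ_{l'<k₃} Pf(m+1+l', m+k₃)·ALo_j(m+1+l') + r_m·Pf(m+1, m+k₃)·ALo_j(m+1))`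
— the young entries on the left undamped, the old age's window products and the young rows on the right at the floor, the defect credit with its one
damping dropped (`θ∕σ ≥ (1−r)∕r`), the chain ratio at its majorant, the cap `1 − x̃₃(m+2) ≥ 1 − k₃c_{m+2}`.  NOT CLAIMED: (★h♯) along flows (successor:
its logarithmic budget and slot certificates, the (E84b)–(E85) machinery); the adversarial census of (★h♯) over concave shapes (kit j335286∕j335288, README);
anything nonlinear; anything printed — NOT B12 Thm 2, NOT BetaPertH.

WHAT IS PROVED ([folklore]; 0 `def`, 0 sorry).  §1 **`rho_top_three`**, **`beta_mid_three`**, **`rho_mid_three`**; §2 **`rho_mid_three_le`**;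
§3 **`static_defect_sup_of_product`**.
-/
noncomputable section
open Finset

namespace Summit.QuantumFields.BalabanUV.Beta.EriceRemainderEnclosureHistoryAutonomyComparisonAgeCompositionThreeAgesDefectReduction

open Literature.MathematicalPhysics.QuantumFieldTheory.Balaban1983to89
open Literature.MathematicalPhysics.QuantumFieldTheory.Balaban1983to89.T4BetaStationary
open Literature.MathematicalPhysics.QuantumFieldTheory.Balaban1983to89.T4BetaFlowWellPosed
open Summit.QuantumFields.BalabanUV.Beta.EriceRemainderEnclosureHistoryAutonomyOrder (strictAnti_of_memFlow)
open Summit.QuantumFields.BalabanUV.Beta.EriceRemainderEnclosureHistoryAutonomyComparisonAgeCompositionIdentification (defect_nonneg prod_damping_pos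
  prod_damping_le_one)
open Summit.QuantumFields.BalabanUV.Beta.EriceRemainderEnclosureHistoryAutonomyComparisonAgeCompositionYoungestTailSumFlow (kernel_entry_le row_mass_le
  load_le_of_window)
open Summit.QuantumFields.BalabanUV.Beta.EriceRemainderEnclosureHistoryAutonomyComparisonAgeCompositionYoungestTailSumWiring (kernel_zero rho_zero beta_zero)
open Summit.QuantumFields.BalabanUV.Beta.EriceRemainderEnclosureHistoryAutonomyComparisonAgeCompositionDecayReduction (inv_prod_le_prod_damping)

variable {B : (ℕ → ℝ) → ℝ} {γ b gIR : ℝ} {L : ℕ → ℝ} {K : ℕ} {h g : ℕ → ℝ} {KL θ : ℕ → ℕ → ℕ → ℝ}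
  {ρ : ℕ → ℕ → ℝ} {β : ℕ → ℕ → ℕ → ℝ}

/-! ## §1 The chain letters of a three-age profile at the middle level -/

/-- For the three-age profile with `K = k₃ + 1` the OLDEST age's chain ratio is its damped row mass: `ρ k₃ n = x̃₃(n)` (no ages above). [folklore] -/
theorem rho_top_three
    (hρ : ∀ i n, 1 ≤ i → i ≤ K - 1 → ρ i n = (∑ l ∈ range K, KL i n l) * (1 + ∑ k ∈ Ioc i (K - 1), θ k n i * β (i + 1) n k) /
      (1 - ∑ k ∈ Ioc i (K - 1), ∑ l ∈ range i, KL k n l))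
    {k₃ : ℕ} (hk3 : 1 ≤ k₃) (hKk : K = k₃ + 1) (n : ℕ) : ρ k₃ n = ∑ l ∈ range K, KL k₃ n l := by
  rw [hρ k₃ n hk3 (by omega), show K - 1 = k₃ by omega, Finset.Ioc_self, sum_empty, sum_empty]; ring

/-- For the three-age profile `{1,k₂,k₃}` (`K = k₃+1`, the levels strictly between `k₂` and `k₃` silent) the carried ratio of the oldest age is the same at
every level down to `k₂ + 1`: `β i n k₃ = x̃₃(n)∕(1 − x̃₃(n))` for `k₂ < i ≤ k₃`. [folklore] -/
theorem beta_mid_three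
    (hKL : ∀ k n l, KL k n l = if 0 < k ∧ k < K ∧ l < k then L k * h (n + k) ^ 3 / 2 * ∏ t ∈ Ico (n + 1 + l) (n + k + 1), g t else 0)
    (hρ : ∀ i n, 1 ≤ i → i ≤ K - 1 → ρ i n = (∑ l ∈ range K, KL i n l) * (1 + ∑ k ∈ Ioc i (K - 1), θ k n i * β (i + 1) n k) /
      (1 - ∑ k ∈ Ioc i (K - 1), ∑ l ∈ range i, KL k n l))
    (hβnew : ∀ i n, 1 ≤ i → i ≤ K - 1 → β i n i = ρ i n / (1 - ρ i n))
    (hβold : ∀ i n k, 1 ≤ i → i < k → k ≤ K - 1 → β i n k = β (i + 1) n k / (1 - ρ i n))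
    {k₂ k₃ : ℕ} (hk2 : 2 ≤ k₂) (hk23 : k₂ < k₃) (hKk : K = k₃ + 1) (hL3 : ∀ j, j < K → j ≠ 1 → j ≠ k₂ → j ≠ k₃ → L j = 0) (n : ℕ) :
    ∀ i, k₂ < i → i ≤ k₃ → β i n k₃ = (∑ l ∈ range K, KL k₃ n l) / (1 - ∑ l ∈ range K, KL k₃ n l) := by
  suffices hd : ∀ d i, i + d = k₃ → k₂ < i → β i n k₃ = (∑ l ∈ range K, KL k₃ n l) / (1 - ∑ l ∈ range K, KL k₃ n l) from
    fun i hi hik => hd (k₃ - i) i (by omega) hi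
  intro d
  induction d with
  | zero =>
    intro i hi _
    rw [add_zero] at hi; subst hi
    rw [hβnew i n (by omega) (by omega), rho_top_three hρ (by omega) hKk n]
  | succ d ih =>
    intro i hi hi2
    rw [hβold i n k₃ (by omega) (by omega) (by omega), ih (i + 1) (by omega) (by omega),
      rho_zero hKL hρ (hL3 i (by omega) (by omega) (by omega) (by omega)) (by omega) (by omega) n, sub_zero, div_one]

/-- **THE MIDDLE AGE'S CHAIN RATIO, EXPLICIT.**  For the three-age profile `{1,k₂,k₃}`:
`ρ k₂ n = x̃₂(n)·(1 + θ k₃ n k₂·x̃₃(n)∕(1 − x̃₃(n)))∕(1 − Σ_{l<k₂} KL k₃ n l)` with `x̃ᵢ(n) = Σ_l KL kᵢ n l`. [folklore] -/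
theorem rho_mid_three
    (hKL : ∀ k n l, KL k n l = if 0 < k ∧ k < K ∧ l < k then L k * h (n + k) ^ 3 / 2 * ∏ t ∈ Ico (n + 1 + l) (n + k + 1), g t else 0)
    (hρ : ∀ i n, 1 ≤ i → i ≤ K - 1 → ρ i n = (∑ l ∈ range K, KL i n l) * (1 + ∑ k ∈ Ioc i (K - 1), θ k n i * β (i + 1) n k) /
      (1 - ∑ k ∈ Ioc i (K - 1), ∑ l ∈ range i, KL k n l))
    (hβnew : ∀ i n, 1 ≤ i → i ≤ K - 1 → β i n i = ρ i n / (1 - ρ i n))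
    (hβold : ∀ i n k, 1 ≤ i → i < k → k ≤ K - 1 → β i n k = β (i + 1) n k / (1 - ρ i n))
    {k₂ k₃ : ℕ} (hk2 : 2 ≤ k₂) (hk23 : k₂ < k₃) (hKk : K = k₃ + 1) (hL3 : ∀ j, j < K → j ≠ 1 → j ≠ k₂ → j ≠ k₃ → L j = 0) (n : ℕ) :
    ρ k₂ n = (∑ l ∈ range K, KL k₂ n l) *
      (1 + θ k₃ n k₂ * ((∑ l ∈ range K, KL k₃ n l) / (1 - ∑ l ∈ range K, KL k₃ n l))) / (1 - ∑ l ∈ range k₂, KL k₃ n l) := by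
  have hmem : k₃ ∈ Ioc k₂ (K - 1) := by rw [mem_Ioc]; omega
  have h1 : ∑ k ∈ Ioc k₂ (K - 1), θ k n k₂ * β (k₂ + 1) n k = θ k₃ n k₂ * ((∑ l ∈ range K, KL k₃ n l) / (1 - ∑ l ∈ range K, KL k₃ n l)) := by
    rw [sum_eq_single_of_mem k₃ hmem fun k hk hk3 => ?_, beta_mid_three hKL hρ hβnew hβold hk2 hk23 hKk hL3 n (k₂ + 1) (by omega) (by omega)]
    rw [mem_Ioc] at hk
    rw [beta_zero hKL hρ hβnew hβold (hL3 k (by omega) (by omega) (by omega) hk3) hk.2 n (k₂ + 1) (by omega) (by omega), mul_zero]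
  have h2 : ∑ k ∈ Ioc k₂ (K - 1), ∑ l ∈ range k₂, KL k n l = ∑ l ∈ range k₂, KL k₃ n l := by
    rw [sum_eq_single_of_mem k₃ hmem fun k hk hk3 => ?_]
    rw [mem_Ioc] at hk
    exact sum_eq_zero fun l _ => kernel_zero hKL (hL3 k (by omega) (by omega) (by omega) hk3) n l
  rw [hρ k₂ n (by omega) (by omega), h1, h2]

/-! ## §2 The flow majorant of the middle age's chain ratio -/

/-- **THE MIDDLE AGE'S CHAIN RATIO BELOW ITS FLOW MAJORANT.**  Three-age profile `{1,k₂,k₃}`, `h` a box solution of an isotone memory with floor dominated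
by `L ≥ 0`, any damping of the relaxed class.  At every pin `p ≥ 1`:  `ρ k₂ p ≤ ρUp_p = (k₂q_p)·(1 + ϑ₂(p)·(k₃c_p∕(1−k₃c_p)))∕(1 − k₂c_p)` with
`q_p = L_{k₂}h_{p+k₂}³∕2`, `c_p = L_{k₃}h_{p+k₃}³∕2`, `ϑ₂(p) = 1 − (h_{p+k₃+k₂}∕h_{p+k₃})³·(Π_{t∈[p+k₃+1,p+k₃+k₂]}(1+F_t))⁻¹` — by §1 `rho_mid_three`,
`0 ≤ x̃₂ ≤ k₂q_p`, `0 ≤ x̃₃ ≤ k₃c_p ≤ 3∕4` ((E82b)), `0 ≤ θ k₃ p k₂ ≤ ϑ₂(p)` (its dampings at the floor), `Σ_{l<k₂} KL k₃ p l ≤ k₂c_p < 1`. [folklore] -/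
theorem rho_mid_three_le (hmono : ∀ u v : ℕ → ℝ, SeqBox γ u → SeqBox γ v → (∀ j, u j ≤ v j) → B u ≤ B v)
    (hL : ∀ k, 0 ≤ L k) (hb : 0 < b) (hlo : ∀ u, SeqBox γ u → b ≤ B u) (hdom : ∀ u, SeqBox γ u → ∑ k ∈ range K, L k * u k ≤ B u)
    (hh : SeqBox γ h) (hf : MemFlow B gIR h)
    (hg : ∀ t, 0 < g t ∧ g t ≤ 1) (hgF : ∀ t, 1 / (1 + ∑ k ∈ range K, L k * h (t + k) ^ 3 / 2) ≤ g t)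
    {k₂ k₃ : ℕ} (hk2 : 2 ≤ k₂) (hk23 : k₂ < k₃) (hKk : K = k₃ + 1) (hL3 : ∀ j, j < K → j ≠ 1 → j ≠ k₂ → j ≠ k₃ → L j = 0)
    (hKL : ∀ k n l, KL k n l = if 0 < k ∧ k < K ∧ l < k then L k * h (n + k) ^ 3 / 2 * ∏ t ∈ Ico (n + 1 + l) (n + k + 1), g t else 0)
    (hθ : ∀ k n l, θ k n l = 1 - (h (n + k + l) / h (n + k)) ^ 3 * ∏ t ∈ Ico (n + k + 1) (n + k + l + 1), g t)
    (hρ : ∀ i n, 1 ≤ i → i ≤ K - 1 → ρ i n = (∑ l ∈ range K, KL i n l) * (1 + ∑ k ∈ Ioc i (K - 1), θ k n i * β (i + 1) n k) /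
      (1 - ∑ k ∈ Ioc i (K - 1), ∑ l ∈ range i, KL k n l))
    (hβnew : ∀ i n, 1 ≤ i → i ≤ K - 1 → β i n i = ρ i n / (1 - ρ i n))
    (hβold : ∀ i n k, 1 ≤ i → i < k → k ≤ K - 1 → β i n k = β (i + 1) n k / (1 - ρ i n))
    {q c F ρUp : ℕ → ℝ} (hq : ∀ n, q n = L k₂ * h (n + k₂) ^ 3 / 2) (hc : ∀ n, c n = L k₃ * h (n + k₃) ^ 3 / 2)
    (hF : ∀ t, F t = ∑ j ∈ range K, L j * h (t + j) ^ 3 / 2)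
    (hρUp : ∀ p, ρUp p = (k₂ * q p) * (1 + (1 - (h (p + k₃ + k₂) / h (p + k₃)) ^ 3 * (∏ t ∈ Ico (p + k₃ + 1) (p + k₃ + k₂ + 1), (1 + F t))⁻¹) *
      ((k₃ * c p) / (1 - k₃ * c p))) / (1 - k₂ * c p))
    {p : ℕ} (hp : 1 ≤ p) : ρ k₂ p ≤ ρUp p := by
  have hpos : ∀ n, 0 < h n := fun n => (hh n).1
  have hanti := (strictAnti_of_memFlow hb hlo hh hf).antitone
  have hk2K : k₂ < K := by omega
  have hk3K : k₃ < K := by omega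
  rw [rho_mid_three hKL hρ hβnew hβold hk2 hk23 hKk hL3 p, hρUp]
  -- the masses
  have hx20 : 0 ≤ ∑ l ∈ range K, KL k₂ p l := sum_nonneg fun l _ => (kernel_entry_le hL hh hg hKL k₂ p l).1
  have hx2 : ∑ l ∈ range K, KL k₂ p l ≤ k₂ * q p := by rw [hq]; exact row_mass_le hL hh hg hKL hk2K p
  have hx30 : 0 ≤ ∑ l ∈ range K, KL k₃ p l := sum_nonneg fun l _ => (kernel_entry_le hL hh hg hKL k₃ p l).1
  have hx3 : ∑ l ∈ range K, KL k₃ p l ≤ k₃ * c p := by rw [hc]; exact row_mass_le hL hh hg hKL hk3K p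
  have hx34 : k₃ * c p ≤ 3 / 4 := by
    have h1 := load_le_of_window hmono hL hb hlo hdom hh hf hp hk3K
    have h2 : 0 ≤ (h (p + k₃) / h p) ^ 2 := sq_nonneg _
    rw [hc]; linarith
  have hc0 : 0 ≤ c p := by rw [hc]; have := hL k₃; have := hpos (p + k₃); positivity
  have hΩ0 : 0 ≤ ∑ l ∈ range k₂, KL k₃ p l := sum_nonneg fun l _ => (kernel_entry_le hL hh hg hKL k₃ p l).1
  have hΩ : ∑ l ∈ range k₂, KL k₃ p l ≤ k₂ * c p := by
    calc ∑ l ∈ range k₂, KL k₃ p l ≤ ∑ l ∈ range k₂, c p := sum_le_sum fun l hl => by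
            have := (kernel_entry_le hL hh hg hKL k₃ p l).2
            rw [if_pos (by rw [mem_range] at hl; omega)] at this; rwa [hc]
      _ = k₂ * c p := by rw [sum_const, card_range, nsmul_eq_mul]
  have hk23r : (k₂ : ℝ) ≤ k₃ := by exact_mod_cast hk23.le
  have hΩ1 : k₂ * c p < 1 := by nlinarith
  -- the defect with its dampings at the floor
  have hθ0 : 0 ≤ θ k₃ p k₂ := defect_nonneg hpos hanti hg hθ k₃ p k₂
  have hF0 : ∀ t, 0 ≤ F t := fun t => by
    rw [hF]; exact sum_nonneg fun j _ => by have := hL j; have := hpos (t + j); positivity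
  have hr0 : 0 ≤ (h (p + k₃ + k₂) / h (p + k₃)) ^ 3 := by have := hpos (p + k₃ + k₂); have := hpos (p + k₃); positivity
  have hθup : θ k₃ p k₂ ≤ 1 - (h (p + k₃ + k₂) / h (p + k₃)) ^ 3 * (∏ t ∈ Ico (p + k₃ + 1) (p + k₃ + k₂ + 1), (1 + F t))⁻¹ := by
    rw [hθ]
    have hgf : (∏ t ∈ Ico (p + k₃ + 1) (p + k₃ + k₂ + 1), (1 + F t))⁻¹ ≤ ∏ t ∈ Ico (p + k₃ + 1) (p + k₃ + k₂ + 1), g t :=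
      inv_prod_le_prod_damping hF0 (fun t => by rw [hF]; exact hgF t) _
    have := mul_le_mul_of_nonneg_left hgf hr0
    linarith
  have hϑ0 : 0 ≤ 1 - (h (p + k₃ + k₂) / h (p + k₃)) ^ 3 * (∏ t ∈ Ico (p + k₃ + 1) (p + k₃ + k₂ + 1), (1 + F t))⁻¹ := hθ0.trans hθup
  -- the old fraction
  have hfrac : (∑ l ∈ range K, KL k₃ p l) / (1 - ∑ l ∈ range K, KL k₃ p l) ≤ (k₃ * c p) / (1 - k₃ * c p) := by
    rw [div_le_div_iff₀ (by linarith) (by linarith)]; nlinarith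
  have hfrac0 : 0 ≤ (∑ l ∈ range K, KL k₃ p l) / (1 - ∑ l ∈ range K, KL k₃ p l) := div_nonneg hx30 (by linarith)
  have hN0 : 0 ≤ 1 + θ k₃ p k₂ * ((∑ l ∈ range K, KL k₃ p l) / (1 - ∑ l ∈ range K, KL k₃ p l)) := by
    have := mul_nonneg hθ0 hfrac0; linarith
  have hNle : 1 + θ k₃ p k₂ * ((∑ l ∈ range K, KL k₃ p l) / (1 - ∑ l ∈ range K, KL k₃ p l)) ≤
      1 + (1 - (h (p + k₃ + k₂) / h (p + k₃)) ^ 3 * (∏ t ∈ Ico (p + k₃ + 1) (p + k₃ + k₂ + 1), (1 + F t))⁻¹) * ((k₃ * c p) / (1 - k₃ * c p)) := by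
    have := mul_le_mul hθup hfrac hfrac0 hϑ0; linarith
  have hnum := mul_le_mul hx2 hNle hN0 (hx20.trans hx2)
  calc (∑ l ∈ range K, KL k₂ p l) * (1 + θ k₃ p k₂ * ((∑ l ∈ range K, KL k₃ p l) / (1 - ∑ l ∈ range K, KL k₃ p l))) /
        (1 - ∑ l ∈ range k₂, KL k₃ p l)
      ≤ (k₂ * q p) * (1 + (1 - (h (p + k₃ + k₂) / h (p + k₃)) ^ 3 * (∏ t ∈ Ico (p + k₃ + 1) (p + k₃ + k₂ + 1), (1 + F t))⁻¹) *
          ((k₃ * c p) / (1 - k₃ * c p))) / (1 - ∑ l ∈ range k₂, KL k₃ p l) := div_le_div_of_nonneg_right hnum (by linarith)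
    _ ≤ (k₂ * q p) * (1 + (1 - (h (p + k₃ + k₂) / h (p + k₃)) ^ 3 * (∏ t ∈ Ico (p + k₃ + 1) (p + k₃ + k₂ + 1), (1 + F t))⁻¹) *
          ((k₃ * c p) / (1 - k₃ * c p))) / (1 - k₂ * c p) :=
        div_le_div_of_nonneg_left ((mul_nonneg hx20 hN0).trans hnum) (by linarith) (by linarith)

/-! ## §3 (S-h♯) at a pin from the damping-free product inequality (★h♯) -/

/-- **(S-h♯) AT A PIN FROM THE DAMPING-FREE, CHAIN-FREE PRODUCT INEQUALITY (★h♯).**  Ages `2 ≤ k₂ < k₃ < K` of the profile, `h` a box solution (non-increasing), `g` any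
damping of the relaxed class, the lone kernels `KL` and defects `θ` as displayed; the middle age's chain ratio `ρ k₂ ≤ 1` everywhere and `≤ ρUp_p` at the
pins `p ≥ 2` (§2); the young lower masses `AL` of the induction; `q_n = L_{k₂}h_{n+k₂}³∕2`, `c_n = L_{k₃}h_{n+k₃}³∕2`, `F_t = Σ_j L_jh_{t+j}³∕2`,
`Pf(a,b) = (Π_{t∈[a,b]}(1+F_t))⁻¹`, `ALo_j(p) = q_p·Σ_{l<k₂} [p+1+l ≤ j]·Pf(p+1+l,p+k₂)·max(1 − ρUp_{p+1+l}, 0)`, `k₃c_{m+2} ≤ 1`.  IF at the pin `m`, for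
every truncation `j ≥ m+1+k₃`, with `r = (h_{m+k₃+1}∕h_{m+k₃})³`:
**(★h♯)** `r·q_{m+1+k₃}·Σ_{l<k₂} [m+2+k₃+l ≤ j] ≤ (1 − k₃c_{m+2})·((1−r)·Σ_{l'<k₃} Pf(m+1+l',m+k₃)·ALo_j(m+1+l') + r·Pf(m+1,m+k₃)·ALo_j(m+1))`,
THEN the (S-h♯) member of (E87h)'s `hpair23` holds at `m` for every such `j`:
`KL k₃ (m+1)(k₃−1)·Σ_{l<k₂} [m+2+k₃+l ≤ j]·KL k₂ (m+1+k₃) l ≤ (1 − Σ_{l<k₃} KL k₃ (m+2) l)·(θ·Σ_{l'} KL k₃ m l'·AL k₂ j (m+1+l') + (1−θ)·KL k₃ m 0·AL k₂ j (m+1))`,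
`θ = θ k₃ m 1 = 1 − r·g_{m+k₃+1}`.  (Left: `KL k₃ (m+1)(k₃−1) = r·c_m·g_{m+k₃+1}`, young entries `≤ q`; right: cap `≥ 1 − k₃c_{m+2} ≥ 0`, old entries
`≥ c_m·Pf`, young lower masses `≥ ALo ≥ 0`; finally `g(1−r) ≤ 1 − rg` for the one damping `g = g_{m+k₃+1} ≤ 1` left over.) [folklore] -/
theorem static_defect_sup_of_product (hL : ∀ k, 0 ≤ L k) (hh : SeqBox γ h) (hanti : Antitone h)
    (hg : ∀ t, 0 < g t ∧ g t ≤ 1) (hgF : ∀ t, 1 / (1 + ∑ k ∈ range K, L k * h (t + k) ^ 3 / 2) ≤ g t)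
    {k₂ k₃ : ℕ} (hk2 : 2 ≤ k₂) (hk23 : k₂ < k₃) (hk3K : k₃ < K)
    (hKL : ∀ k n l, KL k n l = if 0 < k ∧ k < K ∧ l < k then L k * h (n + k) ^ 3 / 2 * ∏ t ∈ Ico (n + 1 + l) (n + k + 1), g t else 0)
    (hθ : ∀ k n l, θ k n l = 1 - (h (n + k + l) / h (n + k)) ^ 3 * ∏ t ∈ Ico (n + k + 1) (n + k + l + 1), g t)
    (hρ1 : ∀ p, ρ k₂ p ≤ 1)
    {AL : ℕ → ℕ → ℕ → ℝ} (hAL : ∀ i j p, AL i j p = ∑ l ∈ range i, if p + 1 + l ≤ j then KL i p l * (1 - ρ i (p + 1 + l)) else 0)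
    {q c F ρUp : ℕ → ℝ} {Pf ALo : ℕ → ℕ → ℝ} (hq : ∀ n, q n = L k₂ * h (n + k₂) ^ 3 / 2) (hc : ∀ n, c n = L k₃ * h (n + k₃) ^ 3 / 2)
    (hF : ∀ t, F t = ∑ j ∈ range K, L j * h (t + j) ^ 3 / 2) (hPf : ∀ a b, Pf a b = (∏ t ∈ Ico a (b + 1), (1 + F t))⁻¹)
    (hρle : ∀ p, 2 ≤ p → ρ k₂ p ≤ ρUp p)
    (hALo : ∀ j p, ALo j p = q p * ∑ l ∈ range k₂, if p + 1 + l ≤ j then Pf (p + 1 + l) (p + k₂) * max (1 - ρUp (p + 1 + l)) 0 else 0)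
    {m : ℕ} (hx1 : k₃ * c (m + 2) ≤ 1)
    (hprod : ∀ j, m + 1 + k₃ ≤ j →
      (h (m + k₃ + 1) / h (m + k₃)) ^ 3 * q (m + 1 + k₃) * (∑ l ∈ range k₂, if m + 2 + k₃ + l ≤ j then (1:ℝ) else 0) ≤
        (1 - k₃ * c (m + 2)) * ((1 - (h (m + k₃ + 1) / h (m + k₃)) ^ 3) * ∑ l' ∈ range k₃, Pf (m + 1 + l') (m + k₃) * ALo j (m + 1 + l') +
          (h (m + k₃ + 1) / h (m + k₃)) ^ 3 * (Pf (m + 1) (m + k₃) * ALo j (m + 1)))) :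
    ∀ j, m + 1 + k₃ ≤ j →
      KL k₃ (m + 1) (k₃ - 1) * ∑ l ∈ range k₂, (if m + 2 + k₃ + l ≤ j then KL k₂ (m + 1 + k₃) l else 0) ≤
        (1 - ∑ l ∈ range k₃, KL k₃ (m + 2) l) *
          ((1 - (1 - θ k₃ m 1)) * ∑ l' ∈ range k₃, KL k₃ m l' * AL k₂ j (m + 1 + l') + (1 - θ k₃ m 1) * (KL k₃ m 0 * AL k₂ j (m + 1))) := by
  intro j hj
  have hpos : ∀ n, 0 < h n := fun n => (hh n).1
  have hk2K : k₂ < K := by omega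
  have hF0 : ∀ t, 0 ≤ F t := fun t => by
    rw [hF]; exact sum_nonneg fun j _ => by have := hL j; have := hpos (t + j); positivity
  have hgF' : ∀ t, 1 / (1 + F t) ≤ g t := fun t => by rw [hF]; exact hgF t
  have hq0 : ∀ n, 0 ≤ q n := fun n => by rw [hq]; have := hL k₂; have := hpos (n + k₂); positivity
  have hc0 : ∀ n, 0 ≤ c n := fun n => by rw [hc]; have := hL k₃; have := hpos (n + k₃); positivity
  have hPf0 : ∀ a b, 0 ≤ Pf a b := fun a b => by rw [hPf]; exact inv_nonneg.mpr (prod_nonneg fun t _ => by have := hF0 t; positivity)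
  -- the letters of the pin: r, G
  set r : ℝ := (h (m + k₃ + 1) / h (m + k₃)) ^ 3 with hr
  set G : ℝ := g (m + k₃ + 1) with hG
  have hr0 : 0 ≤ r := by have := hpos (m + k₃ + 1); have := hpos (m + k₃); positivity
  have hG0 : 0 < G := (hg _).1
  have hG1 : G ≤ 1 := (hg _).2
  have hr3 : h (m + k₃ + 1) ^ 3 = r * h (m + k₃) ^ 3 := by
    rw [hr, div_pow, div_mul_cancel₀ _ (pow_ne_zero 3 (hpos _).ne')]
  have hent : KL k₃ (m + 1) (k₃ - 1) = r * c m * G := by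
    rw [hKL, if_pos ⟨by omega, hk3K, by omega⟩, show m + 1 + 1 + (k₃ - 1) = m + k₃ + 1 by omega, show m + 1 + k₃ + 1 = m + k₃ + 1 + 1 by ring,
      Nat.Ico_succ_singleton, prod_singleton, hc, show m + 1 + k₃ = m + k₃ + 1 by ring, hr3]
    ring
  have hθm : θ k₃ m 1 = 1 - r * G := by rw [hθ, Nat.Ico_succ_singleton, prod_singleton]
  have hθ0 : 0 ≤ 1 - r * G := by have := defect_nonneg hpos hanti hg hθ k₃ m 1; rwa [hθm] at this
  -- LEFT: the young entries below their undamped coefficients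
  have hleft : KL k₃ (m + 1) (k₃ - 1) * ∑ l ∈ range k₂, (if m + 2 + k₃ + l ≤ j then KL k₂ (m + 1 + k₃) l else 0) ≤
      c m * G * (r * q (m + 1 + k₃) * ∑ l ∈ range k₂, if m + 2 + k₃ + l ≤ j then (1:ℝ) else 0) := by
    have hS : ∑ l ∈ range k₂, (if m + 2 + k₃ + l ≤ j then KL k₂ (m + 1 + k₃) l else 0) ≤
        q (m + 1 + k₃) * ∑ l ∈ range k₂, (if m + 2 + k₃ + l ≤ j then (1:ℝ) else 0) := by
      rw [mul_sum]
      refine sum_le_sum fun l hl => ?_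
      have hlk : l < k₂ := mem_range.mp hl
      split_ifs
      · have := (kernel_entry_le hL hh hg hKL k₂ (m + 1 + k₃) l).2
        rw [if_pos hlk, ← hq] at this; linarith
      · simp
    rw [hent, show r * c m * G * _ = c m * G * (r * ∑ l ∈ range k₂, (if m + 2 + k₃ + l ≤ j then KL k₂ (m + 1 + k₃) l else 0)) by ring]
    exact mul_le_mul_of_nonneg_left (by nlinarith [mul_le_mul_of_nonneg_left hS hr0]) (mul_nonneg (hc0 m) hG0.le)
  -- RIGHT: the cap, the old entries at the floor, the young lower masses below AL
  have hcap0 : 0 ≤ 1 - k₃ * c (m + 2) := by linarith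
  have hcap : 1 - k₃ * c (m + 2) ≤ 1 - ∑ l ∈ range k₃, KL k₃ (m + 2) l := by
    have : ∑ l ∈ range k₃, KL k₃ (m + 2) l ≤ ∑ l ∈ range k₃, c (m + 2) := sum_le_sum fun l hl => by
      have := (kernel_entry_le hL hh hg hKL k₃ (m + 2) l).2
      rw [if_pos (mem_range.mp hl)] at this; rwa [hc]
    rw [sum_const, card_range, nsmul_eq_mul] at this; linarith
  have hALo0 : ∀ p, 0 ≤ ALo j p := fun p => by
    rw [hALo]; exact mul_nonneg (hq0 p) (sum_nonneg fun l _ => by split_ifs <;> [exact mul_nonneg (hPf0 _ _) (le_max_right _ _); exact le_rfl])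
  have hALge : ∀ p, 1 ≤ p → ALo j p ≤ AL k₂ j p := by
    intro p hp
    rw [hALo, hAL, mul_sum]
    refine sum_le_sum fun l hl => ?_
    have hlk : l < k₂ := mem_range.mp hl
    split_ifs with hpl
    · have hfloor : q p * Pf (p + 1 + l) (p + k₂) ≤ KL k₂ p l := by
        rw [hKL, if_pos ⟨by omega, hk2K, hlk⟩, ← hq, hPf]
        exact mul_le_mul_of_nonneg_left (inv_prod_le_prod_damping hF0 hgF' _) (hq0 p)
      have hρ' : max (1 - ρUp (p + 1 + l)) 0 ≤ 1 - ρ k₂ (p + 1 + l) :=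
        max_le (by linarith [hρle (p + 1 + l) (by omega)]) (by linarith [hρ1 (p + 1 + l)])
      have hm0 : 0 ≤ max (1 - ρUp (p + 1 + l)) 0 := le_max_right _ _
      have hprod' : (q p * Pf (p + 1 + l) (p + k₂)) * max (1 - ρUp (p + 1 + l)) 0 ≤ KL k₂ p l * (1 - ρ k₂ (p + 1 + l)) :=
        mul_le_mul hfloor hρ' hm0 (kernel_entry_le hL hh hg hKL k₂ p l).1
      linarith
    · simp
  have hold : ∀ l', l' < k₃ → c m * Pf (m + 1 + l') (m + k₃) ≤ KL k₃ m l' := fun l' hl' => by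
    rw [hKL, if_pos ⟨by omega, hk3K, hl'⟩, ← hc, hPf]
    exact mul_le_mul_of_nonneg_left (inv_prod_le_prod_damping hF0 hgF' _) (hc0 m)
  set A' : ℝ := ∑ l' ∈ range k₃, Pf (m + 1 + l') (m + k₃) * ALo j (m + 1 + l') with hA'
  set B' : ℝ := Pf (m + 1) (m + k₃) * ALo j (m + 1) with hB'
  have hA0 : 0 ≤ A' := sum_nonneg fun l' _ => mul_nonneg (hPf0 _ _) (hALo0 _)
  have hB0 : 0 ≤ B' := mul_nonneg (hPf0 _ _) (hALo0 _)
  have hAle : c m * A' ≤ ∑ l' ∈ range k₃, KL k₃ m l' * AL k₂ j (m + 1 + l') := by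
    rw [hA', mul_sum]
    refine sum_le_sum fun l' hl' => ?_
    rw [← mul_assoc]
    exact mul_le_mul (hold l' (mem_range.mp hl')) (hALge _ (by omega)) (hALo0 _) (kernel_entry_le hL hh hg hKL k₃ m l').1
  have hBle : c m * B' ≤ KL k₃ m 0 * AL k₂ j (m + 1) := by
    rw [hB', ← mul_assoc]
    have h0 := hold 0 (by omega); rw [add_zero] at h0
    exact mul_le_mul h0 (hALge _ (by omega)) (hALo0 _) (kernel_entry_le hL hh hg hKL k₃ m 0).1
  have hright : c m * (1 - k₃ * c (m + 2)) * ((1 - r * G) * A' + r * G * B') ≤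
      (1 - ∑ l ∈ range k₃, KL k₃ (m + 2) l) *
        ((1 - (1 - θ k₃ m 1)) * ∑ l' ∈ range k₃, KL k₃ m l' * AL k₂ j (m + 1 + l') + (1 - θ k₃ m 1) * (KL k₃ m 0 * AL k₂ j (m + 1))) := by
    rw [hθm, sub_sub_cancel, sub_sub_cancel]
    have h1 : (1 - r * G) * (c m * A') + r * G * (c m * B') ≤
        (1 - r * G) * ∑ l' ∈ range k₃, KL k₃ m l' * AL k₂ j (m + 1 + l') + r * G * (KL k₃ m 0 * AL k₂ j (m + 1)) := by
      have := mul_le_mul_of_nonneg_left hAle hθ0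
      have := mul_le_mul_of_nonneg_left hBle (mul_nonneg hr0 hG0.le)
      linarith
    have h0 : 0 ≤ (1 - r * G) * (c m * A') + r * G * (c m * B') := by
      have := mul_nonneg hθ0 (mul_nonneg (hc0 m) hA0); have := mul_nonneg (mul_nonneg hr0 hG0.le) (mul_nonneg (hc0 m) hB0); linarith
    calc c m * (1 - k₃ * c (m + 2)) * ((1 - r * G) * A' + r * G * B')
        = (1 - k₃ * c (m + 2)) * ((1 - r * G) * (c m * A') + r * G * (c m * B')) := by ring
      _ ≤ (1 - ∑ l ∈ range k₃, KL k₃ (m + 2) l) * ((1 - r * G) * (c m * A') + r * G * (c m * B')) := mul_le_mul_of_nonneg_right hcap h0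
      _ ≤ _ := mul_le_mul_of_nonneg_left h1 (hcap0.trans hcap)
  -- (★h♯) in the middle, and the one damping left over: G(1−r) ≤ 1 − rG
  have hmid : c m * G * (r * q (m + 1 + k₃) * ∑ l ∈ range k₂, if m + 2 + k₃ + l ≤ j then (1:ℝ) else 0) ≤
      c m * G * ((1 - k₃ * c (m + 2)) * ((1 - r) * A' + r * B')) :=
    mul_le_mul_of_nonneg_left (by have := hprod j hj; rwa [← hA', ← hB'] at this) (mul_nonneg (hc0 m) hG0.le)
  have hlast : c m * G * ((1 - k₃ * c (m + 2)) * ((1 - r) * A' + r * B')) ≤ c m * (1 - k₃ * c (m + 2)) * ((1 - r * G) * A' + r * G * B') := by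
    have hGr : G * (1 - r) ≤ 1 - r * G := by nlinarith
    have := mul_le_mul_of_nonneg_right hGr hA0
    have h0 : 0 ≤ c m * (1 - k₃ * c (m + 2)) := mul_nonneg (hc0 m) hcap0
    nlinarith [mul_le_mul_of_nonneg_left this h0]
  exact hleft.trans (hmid.trans (hlast.trans hright))

end Summit.QuantumFields.BalabanUV.Beta.EriceRemainderEnclosureHistoryAutonomyComparisonAgeCompositionThreeAgesDefectReduction

end
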